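import Mathlib.Combinatorics.SimpleGraph.Acyclic
import Mathlib.Combinatorics.SimpleGraph.Metric
import Mathlib.Data.Set.Card
import Mathlib.Data.Fintype.Lattice

/-!
# Finite group actions on trees: a common fixed vertex or a common invariant edge

The classical fact behind [SemiAnbd] Lemma 1.8 (ii)(a) ("implicit in the theory of [Serre]",
Mochizuki, *Semi-graphs of Anabelioids*, Publ. RIMS **42** (2006), §1 p. 20
[cite: MochizukiSemiAnbd2006, Lem. 1.8(ii)(a) p.20]; Serre, *Trees*, I.6.5): a family of
automorphisms of an acyclic simple graph `T` preserving a finite nonempty set `S` of vertices that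
induces a connected subgraph (a finite subtree) has a common fixed vertex in `S`, or a common
invariant edge of `S` (each automorphism fixing or reversing it).

Proof (leaf stripping): if `S` is a single vertex it is fixed; otherwise the finite tree `T[S]` has
leaves (vertices with exactly one neighbour in `S`); automorphisms permute the leaves; removing them
leaves a smaller nonempty connected set unless all vertices are leaves, in which case `S` is a
single edge.  Everything is phrased for a set `Φ` of maps `V → V` that are injective, respect
adjacency in both directions, and map `S` onto itself — no new definitions are introduced.

Used for [SemiAnbd] Lemma 1.8 (ii)(a) in `FreeGroupsAndActionsProofs4.lean`.
-/

namespace Literature.AnabelianGeometry.SemiGraphs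

namespace TreeFixedPoint

open SimpleGraph

universe u

variable {V : Type u} {T : SimpleGraph V}

/-- An interior vertex of a path of the induced graph `T[S]` has two distinct neighbours in `S`,
so it is not a leaf of `S`. [cite: MochizukiSemiAnbd2006, Lem. 1.8(ii)(a) p.20] -/
theorem not_leaf_of_interior {S : Set V} {a b : S} (p : (T.induce S).Walk a b) (hp : p.IsPath)
    {i : ℕ} (hi0 : 0 < i) (hi : i < p.length) :
    ¬ ∃! y, y ∈ S ∧ T.Adj (p.getVert i).1 y := by
  rintro ⟨y, -, huniq⟩
  have h1 : T.Adj (p.getVert i).1 (p.getVert (i - 1)).1 := by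
    have h := p.adj_getVert_succ (i := i - 1) (by omega)
    rw [show i - 1 + 1 = i from by omega] at h
    exact (SimpleGraph.induce_adj.mp h).symm
  have h2 : T.Adj (p.getVert i).1 (p.getVert (i + 1)).1 :=
    SimpleGraph.induce_adj.mp (p.adj_getVert_succ hi)
  have e1 := huniq _ ⟨(p.getVert (i - 1)).2, h1⟩
  have e2 := huniq _ ⟨(p.getVert (i + 1)).2, h2⟩
  have h3 : p.getVert (i - 1) = p.getVert (i + 1) := Subtype.ext (e1.trans e2.symm)
  have h4 : i - 1 = i + 1 :=
    hp.getVert_injOn (by change i - 1 ≤ p.length; omega) (by change i + 1 ≤ p.length; omega) h3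
  omega

/-- A finite subtree with at least two vertices has a leaf: a vertex at maximal distance from a base
point has exactly one neighbour in `S`. [cite: MochizukiSemiAnbd2006, Lem. 1.8(ii)(a) p.20] -/
theorem exists_leaf (hT : T.IsAcyclic) {S : Set V} (hS : S.Finite) (hconn : (T.induce S).Connected)
    (h2 : 2 ≤ S.ncard) : ∃ u ∈ S, ∃! y, y ∈ S ∧ T.Adj u y := by
  classical
  haveI : Finite S := hS.to_subtype
  obtain ⟨x₀⟩ := hconn.nonempty
  haveI : Nonempty S := ⟨x₀⟩
  have hT' : (T.induce S).IsAcyclic := hT.induce S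
  -- a vertex at maximal distance from `x₀`
  obtain ⟨u, hu⟩ := Finite.exists_max (fun u : S => (T.induce S).dist x₀ u)
  have hne : x₀ ≠ u := by
    intro h
    obtain ⟨a, ha, b, hb, hab⟩ := (Set.one_lt_ncard hS).mp (by omega)
    have key : ∀ c ∈ S, c = x₀.1 := by
      intro c hc
      by_contra hcx
      have h1 := hu ⟨c, hc⟩
      rw [← h, SimpleGraph.dist_self] at h1
      have h2 := (hconn x₀ ⟨c, hc⟩).pos_dist_of_ne
        (fun h' => hcx (congrArg Subtype.val h').symm)
      omega
    exact hab ((key a ha).trans (key b hb).symm)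
  obtain ⟨p, hp, hpl⟩ := (hconn x₀ u).exists_path_of_dist
  have hpnil : ¬ p.Nil := p.not_nil_of_ne hne
  refine ⟨u.1, u.2, p.penultimate.1, ⟨p.penultimate.2, ?_⟩, ?_⟩
  · exact (SimpleGraph.induce_adj.mp (p.adj_penultimate hpnil)).symm
  · rintro y ⟨hyS, hy⟩
    have hadj : (T.induce S).Adj u ⟨y, hyS⟩ := SimpleGraph.induce_adj.mpr hy
    by_cases hys : (⟨y, hyS⟩ : S) ∈ p.support
    · exact congrArg Subtype.val (hT'.eq_penultimate_of_adj_end hp hadj hys)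
    · exfalso
      have hq : (p.concat hadj).IsPath := hp.concat hys hadj
      obtain ⟨q, hq', hql⟩ := (hconn x₀ ⟨y, hyS⟩).exists_path_of_dist
      have heq := hT'.path_unique ⟨p.concat hadj, hq⟩ ⟨q, hq'⟩
      have hlen : (p.concat hadj).length = q.length := by
        rw [show q = p.concat hadj from (congrArg Subtype.val heq).symm]
      rw [SimpleGraph.Walk.length_concat] at hlen
      have h3 := hu ⟨y, hyS⟩
      change (T.induce S).dist x₀ ⟨y, hyS⟩ ≤ (T.induce S).dist x₀ u at h3
      omega

/-- If every vertex of a finite subtree is a leaf, the subtree is a single edge: it consists of a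
leaf `u` and its neighbour. [cite: MochizukiSemiAnbd2006, Lem. 1.8(ii)(a) p.20] -/
theorem subset_pair_of_all_leaves {S : Set V} (hconn : (T.induce S).Connected)
    (hall : ∀ x ∈ S, ∃! y, y ∈ S ∧ T.Adj x y) {u y : V} (hu : u ∈ S)
    (hy : ∀ z, z ∈ S ∧ T.Adj u z → z = y) : S ⊆ {u, y} := by
  intro z hz
  obtain ⟨p, hp, -⟩ := (hconn ⟨u, hu⟩ ⟨z, hz⟩).exists_path_of_dist
  by_cases h2 : 2 ≤ p.length
  · exact absurd (hall _ (p.getVert 1).2) (not_leaf_of_interior p hp Nat.one_pos (by omega))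
  · by_cases h0 : p.length = 0
    · have := p.eq_of_length_eq_zero h0
      exact Or.inl (congrArg Subtype.val this).symm
    · have h1 : p.length = 1 := by omega
      have hadj := p.adj_getVert_succ (i := 0) (by omega)
      rw [p.getVert_zero, zero_add, ← h1, p.getVert_length] at hadj
      exact Or.inr (hy z ⟨hz, SimpleGraph.induce_adj.mp hadj⟩)

/-- Removing the leaves of a finite subtree leaves a connected set (if nonempty): the geodesic
between two non-leaves passes only through non-leaves.
[cite: MochizukiSemiAnbd2006, Lem. 1.8(ii)(a) p.20] -/
theorem nonleaves_connected {S : Set V} (hconn : (T.induce S).Connected)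
    (hne : {x | x ∈ S ∧ ¬ ∃! y, y ∈ S ∧ T.Adj x y}.Nonempty) :
    (T.induce {x | x ∈ S ∧ ¬ ∃! y, y ∈ S ∧ T.Adj x y}).Connected := by
  classical
  rw [SimpleGraph.connected_iff]
  refine ⟨?_, ⟨⟨hne.some, hne.some_mem⟩⟩⟩
  rintro ⟨a, haS, ha⟩ ⟨b, hbS, hb⟩
  obtain ⟨p, hp⟩ := hconn.exists_isPath ⟨a, haS⟩ ⟨b, hbS⟩
  have hsupp : ∀ z ∈ (p.map (SimpleGraph.Embedding.induce S).toHom).support,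
      z ∈ {x | x ∈ S ∧ ¬ ∃! y, y ∈ S ∧ T.Adj x y} := by
    intro z hz
    rw [SimpleGraph.Walk.support_map, List.mem_map] at hz
    obtain ⟨w, hw, rfl⟩ := hz
    obtain ⟨i, hi, hil⟩ := SimpleGraph.Walk.mem_support_iff_exists_getVert.mp hw
    subst hi
    by_cases hi0 : i = 0
    · subst hi0
      rw [SimpleGraph.Walk.getVert_zero]
      exact ⟨haS, ha⟩
    by_cases hil' : i = p.length
    · subst hil'
      rw [SimpleGraph.Walk.getVert_length]
      exact ⟨hbS, hb⟩
    exact ⟨(p.getVert i).2, not_leaf_of_interior p hp (by omega) (by omega)⟩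
  exact ⟨(p.map (SimpleGraph.Embedding.induce S).toHom).induce _ hsupp⟩

/-- Being a leaf of `S` is transported by a map that is injective, respects adjacency in both
directions and maps `S` onto itself. [cite: MochizukiSemiAnbd2006, Lem. 1.8(ii)(a) p.20] -/
theorem leaf_iff_of_auto {S : Set V} {φ : V → V} (hinj : Function.Injective φ)
    (hadj : ∀ x y, T.Adj x y ↔ T.Adj (φ x) (φ y)) (hS : ∀ x, x ∈ S ↔ φ x ∈ S)
    (hsurj : ∀ y ∈ S, ∃ x ∈ S, φ x = y) (x : V) :
    (∃! y, y ∈ S ∧ T.Adj x y) ↔ (∃! y, y ∈ S ∧ T.Adj (φ x) y) := by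
  constructor
  · rintro ⟨y, ⟨hyS, hy⟩, huniq⟩
    refine ⟨φ y, ⟨(hS y).mp hyS, (hadj x y).mp hy⟩, ?_⟩
    rintro z ⟨hzS, hz⟩
    obtain ⟨z', hz'S, rfl⟩ := hsurj z hzS
    rw [huniq z' ⟨hz'S, (hadj x z').mpr hz⟩]
  · rintro ⟨z, ⟨hzS, hz⟩, huniq⟩
    obtain ⟨y, hyS, rfl⟩ := hsurj z hzS
    refine ⟨y, ⟨hyS, (hadj x y).mpr hz⟩, ?_⟩
    rintro w ⟨hwS, hw⟩
    exact hinj (huniq (φ w) ⟨(hS w).mp hwS, (hadj x w).mp hw⟩)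

/-- **Fixed vertex or invariant edge.**  Let `T` be an acyclic simple graph and `Φ` a set of maps
`V → V` that are injective and respect adjacency in both directions.  If a finite nonempty set `S`
of vertices with `T[S]` connected is mapped onto itself by every `φ ∈ Φ`, then some vertex of `S` is
fixed by all of `Φ`, or some edge of `T` with both ends in `S` is fixed or reversed by every
`φ ∈ Φ`. (Finite groups acting on trees, [Serre] I.6.5; [SemiAnbd] Lemma 1.8 (ii)(a).)
[cite: MochizukiSemiAnbd2006, Lem. 1.8(ii)(a) p.20] -/
theorem exists_fixed_or_invariant_edge (hT : T.IsAcyclic) (Φ : Set (V → V))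
    (hΦ : ∀ φ ∈ Φ, Function.Injective φ ∧ ∀ x y, T.Adj x y ↔ T.Adj (φ x) (φ y)) :
    ∀ (n : ℕ) (S : Set V), S.ncard = n → S.Finite → S.Nonempty → (T.induce S).Connected →
      (∀ φ ∈ Φ, (∀ x, x ∈ S ↔ φ x ∈ S) ∧ (∀ y ∈ S, ∃ x ∈ S, φ x = y)) →
      (∃ x ∈ S, ∀ φ ∈ Φ, φ x = x) ∨
      (∃ x ∈ S, ∃ y ∈ S, T.Adj x y ∧ ∀ φ ∈ Φ, (φ x = x ∧ φ y = y) ∨ (φ x = y ∧ φ y = x)) := by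
  intro n
  induction n using Nat.strong_induction_on with
  | _ n ih =>
  intro S hn hS hne hconn hΦS
  by_cases h1 : S.ncard = 1
  · obtain ⟨x, rfl⟩ := Set.ncard_eq_one.mp h1
    exact Or.inl ⟨x, rfl, fun φ hφ => ((hΦS φ hφ).1 x).mp rfl⟩
  have h2 : 2 ≤ S.ncard := by
    have := (Set.ncard_pos hS).mpr hne
    omega
  obtain ⟨u, huS, hu⟩ := exists_leaf hT hS hconn h2
  -- the non-leaves
  set S' : Set V := {x | x ∈ S ∧ ¬ ∃! y, y ∈ S ∧ T.Adj x y} with hS'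
  have hS'S : S' ⊆ S := fun x hx => hx.1
  by_cases hS'ne : S'.Nonempty
  · -- strip the leaves and recurse
    have hlt : S'.ncard < S.ncard :=
      Set.ncard_lt_ncard ⟨hS'S, fun h => (h huS).2 hu⟩ hS
    have hΦS' : ∀ φ ∈ Φ, (∀ x, x ∈ S' ↔ φ x ∈ S') ∧ (∀ y ∈ S', ∃ x ∈ S', φ x = y) := by
      intro φ hφ
      obtain ⟨hinj, hadj⟩ := hΦ φ hφ
      obtain ⟨hSφ, hsurj⟩ := hΦS φ hφ
      have hleaf := fun x => leaf_iff_of_auto (T := T) hinj hadj hSφ hsurj x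
      refine ⟨fun x => ?_, fun y hy => ?_⟩
      · change (x ∈ S ∧ _) ↔ (φ x ∈ S ∧ _)
        rw [hSφ x, hleaf x]
      · obtain ⟨x, hxS, rfl⟩ := hsurj y hy.1
        exact ⟨x, ⟨hxS, fun h => hy.2 ((hleaf x).mp h)⟩, rfl⟩
    rcases ih S'.ncard (hn ▸ hlt) S' rfl (hS.subset hS'S) hS'ne (nonleaves_connected hconn hS'ne)
      hΦS' with ⟨x, hx, hfix⟩ | ⟨x, hx, y, hy, hxy, hfix⟩
    · exact Or.inl ⟨x, hx.1, hfix⟩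
    · exact Or.inr ⟨x, hx.1, y, hy.1, hxy, hfix⟩
  · -- all vertices are leaves: `S` is a single edge
    have hall : ∀ x ∈ S, ∃! y, y ∈ S ∧ T.Adj x y := by
      intro x hx
      by_contra hx'
      exact hS'ne ⟨x, hx, hx'⟩
    obtain ⟨y, ⟨hyS, huy⟩, hyuniq⟩ := hu
    have hsub : S ⊆ {u, y} := subset_pair_of_all_leaves hconn hall huS hyuniq
    have huy' : u ≠ y := huy.ne
    refine Or.inr ⟨u, huS, y, hyS, huy, fun φ hφ => ?_⟩
    obtain ⟨hinj, -⟩ := hΦ φ hφ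
    obtain ⟨hSφ, -⟩ := hΦS φ hφ
    have hu' := hsub ((hSφ u).mp huS)
    have hy' := hsub ((hSφ y).mp hyS)
    rcases hu' with hu' | hu'
    · refine Or.inl ⟨hu', ?_⟩
      rcases hy' with hy' | hy'
      · exact absurd (hinj (hy'.trans hu'.symm)) huy'.symm
      · exact hy'
    · refine Or.inr ⟨hu', ?_⟩
      rcases hy' with hy' | hy'
      · exact hy'
      · exact absurd (hinj (hu'.trans hy'.symm)) huy'

end TreeFixedPoint

end Literature.AnabelianGeometry.SemiGraphs
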